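import Summits.HodgeConjecture.HodgeConjecture.Theorems.Ring2WeilCoverageCMFieldCellsKaehler
import Summits.HodgeConjecture.HodgeConjecture.Theorems.Ring2WeilCoverageCMFieldCellsSign
import Summits.HodgeConjecture.HodgeConjecture.Theorems.Ring2WeilCoverageCMFieldCellsHodgeAtMember
import Literature.AlgebraicGeometry.ComplexMultiplication.CMAbelianVarietyRealisedHolds
import Literature.AlgebraicGeometry.ComplexMultiplication.CMTypeConjugateIsogeny
import Literature.NumberTheory.ComplexMultiplication.CMTypeBasic
import Literature.AlgebraicGeometry.HodgeTheory.CMProductsHodgeConjectureOfCodimTwo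
import HarnessLib

/-!
# Ring 2 — Weil-type family-coverage census, CM-field rows (X-F): a row `(E, 2p, δ)` of a Galois CM field carries a
# POLARIZED Weil-type CM member IFF `sign_τ δ = (-1)^p` at every real place — and then the census member
# `B^p × (B^ρ)^p` with a Kähler polarization

HONEST FRAMING: research route conditional on HC_CM; not a corollary; Q11.4-sentence-2 already refuted in dim ≥ 3.

Cell `pub-hodge-ring2`, seat `ring2-b03` (gen 55), census `WEIL-FAMILY-COVERAGE.md` «## b03» (rows `W8.E.δ`, «δ totally
positive»; index set = finite EVEN sets of non-split places, b03.5). THEOREMS ONLY: no `def`, no named fact, no `sorry`;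
nothing here is a case of the Hodge conjecture, `HC_CM` does not occur. Assembles part X-D
(`Ring2WeilCoverageCMFieldCellsSign`: NECESSITY of the sign, Deligne (1) from Hodge–Riemann, every CM field) and part X-E
(`Ring2WeilCoverageCMFieldCellsKaehler`: Deligne §5 (c) with positivity and an arbitrary right-sign target).

* `exists_cmPower_kaehler_hasWeilDiscriminantCM_of_sign` — SUFFICIENCY by the census member: for `K` Galois CM,
  `[K:ℚ] > 2`, Deligne's presentation `(b₀, R)`, one realisation `B` of a CM type, every `p ≥ 1` and every unit `q` with
  `(-1)^p Re τ(ι q) > 0` at every embedding: the power `B^{2p}` (actions `ι` / `ι ∘ c`) carries a Weil-type `η` and a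
  rational class with a KÄHLER multiple, a polarization class, Rosati-compatible, of discriminant `[q]`.
* `exists_kaehler_member_iff_sign`, `exists_cm_kaehler_member_iff_sign` — **the `iff`**: `[q]` is the discriminant of
  a (CM) Weil-type datum of `E`-rank `2p` polarized by a Kähler-multiple Rosati-compatible rational class IFF
  `(-1)^p Re τ(ι q) > 0` at every embedding `τ : E → ℂ` — the CM-field twin of
  `Ring2.AbelianAll.weilClassesComponent_inhabited_iff_sign` (imaginary quadratic `K`, ab-weil-1 gen 8). For the
  census (`p = 2`): the rows `W8.E.δ` non-empty for polarized members are EXACTLY the totally positive `δ`, each with a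
  CM product member (b03.2 / b03.5 / b03.6 in the kernel for the six Galois census fields).
* `exists_cmPower_kaehler_hodgeConjectureFor_of_isNondegenerate_of_sign`, `…_of_inducedCMType_of_sign` — with part X-C:
  on every right-sign row a Kähler-polarized CM power member AT WHICH THE HODGE CONJECTURE HOLDS (nondegenerate types:
  Pohlmann; induced types: Hazama), `W_E ⊗ ℂ` algebraic there.

HONEST COLUMN: `[IsGalois ℚ K]` for sufficiency (the `D₄` census field is not covered); necessity (part X-D) holds for
every CM field. The typed cells `WeilClassesComponentCM R e₀ p δ` quantify over `IsPolarizationClass` (no positivity)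
and are inhabited for EVERY `δ` (part X-A); the `iff` here is about POLARIZED (Kähler) members.

## References
* [Deligne1982HodgeCycles] P. Deligne (notes by J. S. Milne), LNM 900 (1982), §4 p. 30 (1), Cor. 4.2, (4.5), Lemma 4.6;
  §5 (b)–(c) pp. 38–39.
* [vanGeemen1994HodgeAV] B. van Geemen, LNM 1594 (1994), 4.11, 4.14.
* [Shimura1998] G. Shimura, *Abelian Varieties with Complex Multiplication and Modular Functions* (1998), §5.2 (2), §6.2
  Thm. 3.
-/

noncomputable section

set_option linter.dupNamespace false

namespace Summit.HodgeConjecture.HodgeConjecture.Ring2.WeilCoverageCM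

open CategoryTheory CategoryTheory.Limits Polynomial NumberField
open Literature.AlgebraicTopology.SingularHomology
open Literature.AlgebraicGeometry Literature.AlgebraicGeometry.Motives Literature.AlgebraicGeometry.HodgeTheory
open Literature.AlgebraicGeometry.ComplexMultiplication Literature.AlgebraicGeometry.Deligne1982
open Literature.AlgebraicGeometry.Milne1999
open Literature.NumberTheory.ComplexMultiplication (CMTypeOps.bar CMTypeOps.mem_bar_iff CMTypeOps.conjugate_mem_iff_notMem)
open Summit.HodgeConjecture.CorCM.AndreProductForm (diagHom)
open Literature.AlgebraicGeometry.Pohlmann1968 (IsNondegenerate)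
open Literature.NumberTheory.ComplexMultiplication (inducedCMType)
open Summit.HodgeConjecture.HodgeConjecture.Ring2.Hypotheses (RosatiCompatible IsKaehlerMultiple)
/-! ## The census member with a Kähler polarization on every right-sign row; the `iff` with part X-D -/

section Member

variable (K : Type) [Field K] [NumberField K] [IsCMField K] [IsGalois ℚ K]

/-- `#{j < 2p | j < p} = p` in `Fin (2p)`. [folklore] -/
private theorem card_filter_val_lt_two_mul (p : ℕ) :
    ((Finset.univ : Finset (Fin (2 * p))).filter fun j : Fin (2 * p) => (j : ℕ) < p).card = p := by
  refine Finset.card_eq_of_bijective (fun i (hi : i < p) => (⟨i, by omega⟩ : Fin (2 * p))) (fun a ha => ?_)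
    (fun i hi => ?_) fun i j hi hj hij => ?_
  · exact ⟨a, (Finset.mem_filter.1 ha).2, rfl⟩
  · exact Finset.mem_filter.2 ⟨Finset.mem_univ _, hi⟩
  · exact Fin.mk.inj_iff.mp hij

/-- `#{j < 2p | ¬ j < p} = p` in `Fin (2p)`. [folklore] -/
private theorem card_filter_not_val_lt_two_mul (p : ℕ) :
    ((Finset.univ : Finset (Fin (2 * p))).filter fun j : Fin (2 * p) => ¬ (j : ℕ) < p).card = p := by
  have h := Finset.card_filter_add_card_filter_not (s := (Finset.univ : Finset (Fin (2 * p))))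
    (fun j : Fin (2 * p) => (j : ℕ) < p)
  rw [card_filter_val_lt_two_mul, Finset.card_univ, Fintype.card_fin] at h
  omega

open scoped Classical in
/-- **The census member `B^p × (B^ρ)^p` carries a KÄHLER polarization of every RIGHT-SIGN discriminant.** For `K` Galois
CM with `[K:ℚ] > 2`, Deligne's presentation `(b₀, R)`, ONE realisation `(B, ι, θ)` of a CM type `Ψ`, every `p ≥ 1` and
every unit `q ∈ F^×` with `(-1)^p Re τ(ι q) > 0` at every embedding: on the power `⨁_{j<2p} B` with the actions
`ι` (`j < p`) / `ι ∘ c` (`j ≥ p`), the diagonal `η = ⊕ act_j(b₀)` is of Weil type and there is a rational class `h` with a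
Kähler multiple, a polarization class, Rosati-compatible with `η`, with `HasWeilDiscriminantCM _ η R e₀ p h [q]`.
[cite: Deligne1982HodgeCycles, §5 (b)–(c) pp. 38–39] [cite: Shimura1998, §5.2 (2)] -/
theorem exists_cmPower_kaehler_hasWeilDiscriminantCM_of_sign (hK : 2 < Module.finrank ℚ K)
    {b₀ : 𝓞 K} (hb₀ : IsCMField.complexConj K (b₀ : K) = -(b₀ : K))
    (hsep : Function.Injective fun σ : K →+* ℂ => σ (b₀ : K))
    {R : Polynomial ℤ} {e₀ : ℕ} (he : Module.finrank ℚ K = 2 * e₀) (hRm : R.Monic) (hRdeg : R.natDegree = e₀)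
    (hR : R.comp (X ^ 2) = minpoly ℤ b₀) (hirr : Irreducible (cmPolyQ R))
    (hroots : ∀ s : ℂ, Polynomial.eval₂ (Int.castRingHom ℂ) s R = 0 → s.im = 0 ∧ s.re < 0)
    (haev : Polynomial.aeval (b₀ : K) (cmPolyQ R) = 0) (hdegQ : (cmPolyQ R).natDegree = Module.finrank ℚ K)
    [Fact (Irreducible (realPolyQ R))]
    {Ψ : CMType K} {B : AbelianVariety ℂ} {ι : 𝓞 K →+* End B} {θ : K →+* Module.End ℂ (complexBetti B.X 1)}
    (hB : IsCMTypeRealisation Ψ B ι θ) {p : ℕ} (hp : 0 < p) {q : (realField R)ˣ}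
    (hqsign : ∀ τ : cmField R →+* ℂ, 0 < (-1 : ℝ) ^ p * (τ (realToCM R (q : realField R))).re) :
    ∃ (act : Fin (2 * p) → (𝓞 K →+* End B)) (h : complexBetti (⨁ fun _ : Fin (2 * p) => B).X 2),
      (∀ j : Fin (2 * p), ((j : ℕ) < p → act j = ι) ∧ (¬ (j : ℕ) < p →
        act j = ι.comp (RingOfIntegers.mapRingHom (IsCMField.complexConj K).toRingEquiv.toRingHom))) ∧
      IsOfCMType (⨁ fun _ : Fin (2 * p) => B) ∧
      IsWeilTypeCM (⨁ fun _ : Fin (2 * p) => B) (diagHom K (fun _ => B) act b₀) R e₀ p ∧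
      IsRationalClass h ∧ IsKaehlerMultiple (⨁ fun _ : Fin (2 * p) => B) h ∧
      IsPolarizationClass (⨁ fun _ : Fin (2 * p) => B).dim (⨁ fun _ : Fin (2 * p) => B).X h ∧
      RosatiCompatible (⨁ fun _ : Fin (2 * p) => B) (diagHom K (fun _ => B) act b₀) h ∧
      HasWeilDiscriminantCM (⨁ fun _ : Fin (2 * p) => B) (diagHom K (fun _ => B) act b₀) R e₀ p h
        (QuotientGroup.mk q) := by
  have hbar : ∀ φ : K →+* ℂ, φ ∈ (CMTypeOps.bar Ψ).1 ↔ ComplexEmbedding.conjugate φ ∈ Ψ.1 := fun φ =>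
    (CMTypeOps.mem_bar_iff Ψ φ).trans (CMTypeOps.conjugate_mem_iff_notMem Ψ φ).symm
  have hB' := hB.comp_complexConj hbar
  let ιc : 𝓞 K →+* End B := ι.comp (RingOfIntegers.mapRingHom (IsCMField.complexConj K).toRingEquiv.toRingHom)
  let θc : K →+* Module.End ℂ (complexBetti B.X 1) := θ.comp (IsCMField.complexConj K).toRingEquiv.toRingHom
  let act : Fin (2 * p) → (𝓞 K →+* End B) := fun j => if (j : ℕ) < p then ι else ιc
  let θB : Fin (2 * p) → (K →+* Module.End ℂ (complexBetti B.X 1)) := fun j => if (j : ℕ) < p then θ else θc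
  let Φ : Fin (2 * p) → CMType K := fun j => if (j : ℕ) < p then Ψ else CMTypeOps.bar Ψ
  have hreal : ∀ j, IsCMTypeRealisation (Φ j) B (act j) (θB j) := by
    intro j
    by_cases hj : (j : ℕ) < p
    · simp only [Φ, act, θB, if_pos hj]; exact hB
    · simp only [Φ, act, θB, if_neg hj]; exact hB'
  have hmem : ∀ (s : K →+* ℂ) (j : Fin (2 * p)), s ∈ (Φ j).1 ↔ ((j : ℕ) < p ↔ s ∈ Ψ.1) := by
    intro s j
    by_cases hj : (j : ℕ) < p
    · simp only [Φ, if_pos hj]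
      exact ⟨fun h => ⟨fun _ => h, fun _ => hj⟩, fun h => h.1 hj⟩
    · simp only [Φ, if_neg hj]
      rw [CMTypeOps.mem_bar_iff]
      exact ⟨fun h => ⟨fun h' => absurd h' hj, fun h' => absurd h' h⟩, fun h h' => hj (h.2 h')⟩
  have hadm : ∀ s : K →+* ℂ, (Finset.univ.filter fun j : Fin (2 * p) => s ∈ (Φ j).1).card = p := by
    intro s
    by_cases hs : s ∈ Ψ.1
    · have hfilt : (Finset.univ.filter fun j : Fin (2 * p) => s ∈ (Φ j).1) =
          Finset.univ.filter fun j : Fin (2 * p) => (j : ℕ) < p := by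
        refine Finset.filter_congr fun j _ => ?_
        rw [hmem]
        exact ⟨fun h => h.2 hs, fun h => ⟨fun _ => hs, fun _ => h⟩⟩
      rw [hfilt, card_filter_val_lt_two_mul]
    · have hfilt : (Finset.univ.filter fun j : Fin (2 * p) => s ∈ (Φ j).1) =
          Finset.univ.filter fun j : Fin (2 * p) => ¬ (j : ℕ) < p := by
        refine Finset.filter_congr fun j _ => ?_
        rw [hmem]
        exact ⟨fun h hj => hs (h.1 hj), fun h => ⟨fun hj => absurd hj h, fun h' => absurd h' hs⟩⟩
      rw [hfilt, card_filter_not_val_lt_two_mul]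
  obtain ⟨hW, h, hQ, hK', hpol, hros, hdisc⟩ :=
    exists_kaehlerClass_hasWeilDiscriminantCM_of_constantSum_of_sign K hK rfl hp (fun _ => B) act hreal hadm hb₀ hsep
      he hRm hRdeg hR hirr hroots haev hdegQ hqsign
  refine ⟨act, h, fun j => ⟨fun hj => if_pos hj, fun hj => if_neg hj⟩, ?_, hW, hQ, hK', hpol, hros, hdisc⟩
  exact CMCodimTwo.isOfCMType_biproduct_fin (fun _ => B) fun _ => hB.isOfCMType

/-- **A δ-row of a Galois CM field carries a POLARIZED Weil-type CM member IFF `δ` has the sign `(-1)^p` at every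
real place** — the CM-field twin of `Ring2.AbelianAll.weilClassesComponent_inhabited_iff_sign`. For `K` Galois CM,
`[K:ℚ] > 2`, Deligne's presentation `(b₀, R)`, `p ≥ 1` and a unit `q ∈ F^×`: there is a Weil-type CM datum `(A, η)`
of `E`-rank `2p` with a rational, Rosati-compatible class `h` having a Kähler multiple and `disc = [q]` IF AND ONLY IF
`(-1)^p · Re τ(ι q) > 0` at every embedding `τ : E → ℂ`. (⟹: part X-D, Deligne's (1) from Hodge–Riemann — valid for
every CM field; ⟸: the census member of `exists_cmPower_kaehler_hasWeilDiscriminantCM_of_sign`, which is moreover OF CM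
TYPE.) For `p = 2`: the non-empty rows `W8.E.δ` of the census, for polarized members, are EXACTLY the totally positive
classes `δ`. [cite: Deligne1982HodgeCycles, §4 p. 30 (1), (4.5); §5 (c) pp. 38–39] [cite: vanGeemen1994HodgeAV, 4.11, 4.14] -/
theorem exists_kaehler_member_iff_sign (hK : 2 < Module.finrank ℚ K)
    {b₀ : 𝓞 K} (hb₀ : IsCMField.complexConj K (b₀ : K) = -(b₀ : K))
    (hsep : Function.Injective fun σ : K →+* ℂ => σ (b₀ : K))
    {R : Polynomial ℤ} {e₀ : ℕ} (he : Module.finrank ℚ K = 2 * e₀) (hRm : R.Monic) (hRdeg : R.natDegree = e₀)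
    (hR : R.comp (X ^ 2) = minpoly ℤ b₀) (hirr : Irreducible (cmPolyQ R))
    (hroots : ∀ s : ℂ, Polynomial.eval₂ (Int.castRingHom ℂ) s R = 0 → s.im = 0 ∧ s.re < 0)
    (haev : Polynomial.aeval (b₀ : K) (cmPolyQ R) = 0) (hdegQ : (cmPolyQ R).natDegree = Module.finrank ℚ K)
    [Fact (Irreducible (realPolyQ R))] {p : ℕ} (hp : 0 < p) (q : (realField R)ˣ) :
    (∃ (A : AbelianVariety ℂ) (η : A ⟶ A) (h : complexBetti A.X 2), IsWeilTypeCM A η R e₀ p ∧ IsRationalClass h ∧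
      RosatiCompatible A η h ∧ IsKaehlerMultiple A h ∧
      HasWeilDiscriminantCM A η R e₀ p h (QuotientGroup.mk q : cmNormResidueGroup R)) ↔
    ∀ τ : cmField R →+* ℂ, 0 < (-1 : ℝ) ^ p * (τ (realToCM R (q : realField R))).re := by
  constructor
  · rintro ⟨A, η, h, hW, hQ, hros, hKm, hδ⟩ τ
    exact re_pos_of_hasWeilDiscriminantCM_of_isKaehlerMultiple hW hQ hros hKm hδ rfl τ
  · intro hqsign
    obtain ⟨Ψ⟩ := nonempty_cmType_of_isCMField (K := K)
    obtain ⟨B, ι, θ, hB⟩ := exists_isCMTypeRealisation Ψ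
    obtain ⟨act, h, -, -, hW, hQ, hKm, -, hros, hdisc⟩ :=
      exists_cmPower_kaehler_hasWeilDiscriminantCM_of_sign K hK hb₀ hsep he hRm hRdeg hR hirr hroots haev hdegQ hB hp
        hqsign
    exact ⟨_, _, h, hW, hQ, hros, hKm, hdisc⟩

/-- **The same `iff` with a CM member**: the right-sign rows are exactly those carrying a polarized Weil-type member
that is moreover OF CM TYPE (the census's (F2) member). [cite: Deligne1982HodgeCycles, §4 p. 30 (1); §5 (c) pp. 38–39] -/
theorem exists_cm_kaehler_member_iff_sign (hK : 2 < Module.finrank ℚ K)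
    {b₀ : 𝓞 K} (hb₀ : IsCMField.complexConj K (b₀ : K) = -(b₀ : K))
    (hsep : Function.Injective fun σ : K →+* ℂ => σ (b₀ : K))
    {R : Polynomial ℤ} {e₀ : ℕ} (he : Module.finrank ℚ K = 2 * e₀) (hRm : R.Monic) (hRdeg : R.natDegree = e₀)
    (hR : R.comp (X ^ 2) = minpoly ℤ b₀) (hirr : Irreducible (cmPolyQ R))
    (hroots : ∀ s : ℂ, Polynomial.eval₂ (Int.castRingHom ℂ) s R = 0 → s.im = 0 ∧ s.re < 0)
    (haev : Polynomial.aeval (b₀ : K) (cmPolyQ R) = 0) (hdegQ : (cmPolyQ R).natDegree = Module.finrank ℚ K)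
    [Fact (Irreducible (realPolyQ R))] {p : ℕ} (hp : 0 < p) (q : (realField R)ˣ) :
    (∃ (A : AbelianVariety ℂ) (η : A ⟶ A) (h : complexBetti A.X 2), IsOfCMType A ∧ IsWeilTypeCM A η R e₀ p ∧
      IsRationalClass h ∧ RosatiCompatible A η h ∧ IsKaehlerMultiple A h ∧
      HasWeilDiscriminantCM A η R e₀ p h (QuotientGroup.mk q : cmNormResidueGroup R)) ↔
    ∀ τ : cmField R →+* ℂ, 0 < (-1 : ℝ) ^ p * (τ (realToCM R (q : realField R))).re := by
  constructor
  · rintro ⟨A, η, h, -, hW, hQ, hros, hKm, hδ⟩ τ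
    exact re_pos_of_hasWeilDiscriminantCM_of_isKaehlerMultiple hW hQ hros hKm hδ rfl τ
  · intro hqsign
    obtain ⟨Ψ⟩ := nonempty_cmType_of_isCMField (K := K)
    obtain ⟨B, ι, θ, hB⟩ := exists_isCMTypeRealisation Ψ
    obtain ⟨act, h, -, hcm, hW, hQ, hKm, -, hros, hdisc⟩ :=
      exists_cmPower_kaehler_hasWeilDiscriminantCM_of_sign K hK hb₀ hsep he hRm hRdeg hR hirr hroots haev hdegQ hB hp
        hqsign
    exact ⟨_, _, h, hcm, hW, hQ, hros, hKm, hdisc⟩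

/-- **The census rows `W8.E.δ` (`p = 2`): a row carries a polarized Weil-type CM member IFF `δ` is TOTALLY POSITIVE**
(`Re τ(ι q) > 0` at every embedding for one / every representative `q`), and then a CM member — b03.2's «δ totally
positive» and b03.6's (F2) member, both ways, in the kernel. [cite: Deligne1982HodgeCycles, §4 p. 30 (1); §5 (c) pp. 38–39] -/
theorem exists_cm_kaehler_member_two_iff_totallyPositive (hK : 2 < Module.finrank ℚ K)
    {b₀ : 𝓞 K} (hb₀ : IsCMField.complexConj K (b₀ : K) = -(b₀ : K))
    (hsep : Function.Injective fun σ : K →+* ℂ => σ (b₀ : K))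
    {R : Polynomial ℤ} {e₀ : ℕ} (he : Module.finrank ℚ K = 2 * e₀) (hRm : R.Monic) (hRdeg : R.natDegree = e₀)
    (hR : R.comp (X ^ 2) = minpoly ℤ b₀) (hirr : Irreducible (cmPolyQ R))
    (hroots : ∀ s : ℂ, Polynomial.eval₂ (Int.castRingHom ℂ) s R = 0 → s.im = 0 ∧ s.re < 0)
    (haev : Polynomial.aeval (b₀ : K) (cmPolyQ R) = 0) (hdegQ : (cmPolyQ R).natDegree = Module.finrank ℚ K)
    [Fact (Irreducible (realPolyQ R))] (q : (realField R)ˣ) :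
    (∃ (A : AbelianVariety ℂ) (η : A ⟶ A) (h : complexBetti A.X 2), IsOfCMType A ∧ IsWeilTypeCM A η R e₀ 2 ∧
      IsRationalClass h ∧ RosatiCompatible A η h ∧ IsKaehlerMultiple A h ∧
      HasWeilDiscriminantCM A η R e₀ 2 h (QuotientGroup.mk q : cmNormResidueGroup R)) ↔
    ∀ τ : cmField R →+* ℂ, 0 < (τ (realToCM R (q : realField R))).re := by
  rw [exists_cm_kaehler_member_iff_sign K hK hb₀ hsep he hRm hRdeg hR hirr hroots haev hdegQ two_pos q]
  norm_num

end Member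

/-! ## Polarized CM member WITH the Hodge conjecture at it (parts X-C + X-E) -/

section PolarizedHodge

variable (K : Type) [Field K] [NumberField K] [IsCMField K] [IsGalois ℚ K]

/-- **On every RIGHT-SIGN row: a KÄHLER-polarized CM power member AT WHICH THE HODGE CONJECTURE HOLDS — nondegenerate
types.** For `K` Galois CM, `[K:ℚ] > 2`, Deligne's presentation, `(B, ι, θ)` realising a NONDEGENERATE type, `p ≥ 1`
and `q` with `(-1)^p Re τ(ι q) > 0 ∀τ`: on `B^{2p}` a Weil-type `η`, a rational Kähler-multiple Rosati-compatible
polarization class of discriminant `[q]`, `HodgeConjectureFor` (tree: `Pohlmann1968.IsNondegenerate.hodgeConjectureFor_pow`)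
and `W_E(B^{2p}) ⊗ ℂ` algebraic. [cite: Deligne1982HodgeCycles, §5 (c) pp. 38–39] [cite: Pohlmann1968, Thm. 1] -/
theorem exists_cmPower_kaehler_hodgeConjectureFor_of_isNondegenerate_of_sign (hK : 2 < Module.finrank ℚ K)
    {b₀ : 𝓞 K} (hb₀ : IsCMField.complexConj K (b₀ : K) = -(b₀ : K))
    (hsep : Function.Injective fun σ : K →+* ℂ => σ (b₀ : K))
    {R : Polynomial ℤ} {e₀ : ℕ} (he : Module.finrank ℚ K = 2 * e₀) (hRm : R.Monic) (hRdeg : R.natDegree = e₀)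
    (hR : R.comp (X ^ 2) = minpoly ℤ b₀) (hirr : Irreducible (cmPolyQ R))
    (hroots : ∀ s : ℂ, Polynomial.eval₂ (Int.castRingHom ℂ) s R = 0 → s.im = 0 ∧ s.re < 0)
    (haev : Polynomial.aeval (b₀ : K) (cmPolyQ R) = 0) (hdegQ : (cmPolyQ R).natDegree = Module.finrank ℚ K)
    [Fact (Irreducible (realPolyQ R))]
    {Ψ : CMType K} (hΨ : IsNondegenerate Ψ) {B : AbelianVariety ℂ} {ι : 𝓞 K →+* End B}
    {θ : K →+* Module.End ℂ (complexBetti B.X 1)} (hB : IsCMTypeRealisation Ψ B ι θ) {p : ℕ} (hp : 0 < p)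
    {q : (realField R)ˣ} (hqsign : ∀ τ : cmField R →+* ℂ, 0 < (-1 : ℝ) ^ p * (τ (realToCM R (q : realField R))).re) :
    ∃ (η : (⨁ fun _ : Fin (2 * p) => B) ⟶ ⨁ fun _ : Fin (2 * p) => B)
      (h : complexBetti (⨁ fun _ : Fin (2 * p) => B).X 2),
      IsOfCMType (⨁ fun _ : Fin (2 * p) => B) ∧ IsWeilTypeCM (⨁ fun _ : Fin (2 * p) => B) η R e₀ p ∧
      IsRationalClass h ∧ IsKaehlerMultiple (⨁ fun _ : Fin (2 * p) => B) h ∧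
      IsPolarizationClass (⨁ fun _ : Fin (2 * p) => B).dim (⨁ fun _ : Fin (2 * p) => B).X h ∧
      RosatiCompatible (⨁ fun _ : Fin (2 * p) => B) η h ∧
      HasWeilDiscriminantCM (⨁ fun _ : Fin (2 * p) => B) η R e₀ p h (QuotientGroup.mk q) ∧
      HodgeConjectureFor (⨁ fun _ : Fin (2 * p) => B).dim (⨁ fun _ : Fin (2 * p) => B).X ∧
      weilClassesField (⨁ fun _ : Fin (2 * p) => B) η (R.comp (X ^ 2)) (2 * p) ≤
        algebraicClasses (⨁ fun _ : Fin (2 * p) => B).X p := by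
  obtain ⟨act, h, -, hcm, hW, hQ, hKm, hpol, hros, hdisc⟩ :=
    exists_cmPower_kaehler_hasWeilDiscriminantCM_of_sign K hK hb₀ hsep he hRm hRdeg hR hirr hroots haev hdegQ hB hp hqsign
  have hHC : HodgeConjectureFor (⨁ fun _ : Fin (2 * p) => B).dim (⨁ fun _ : Fin (2 * p) => B).X :=
    hΨ.hodgeConjectureFor_pow hB (2 * p)
  exact ⟨_, h, hcm, hW, hQ, hKm, hpol, hros, hdisc, hHC,
    hW.weilClassesField_le_algebraicClasses_of_hodgeConjectureFor hHC⟩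

variable {K₁ : Type} [Field K₁] [NumberField K₁] [IsCMField K₁] [Algebra K₁ K]

/-- **The same for INDUCED types** (`B` realising `Ind Φ₁`, `Φ₁` a nondegenerate type of a CM subfield `K₁ ⊆ K`; HC
by Hazama's criterion, `hodgeConjectureFor_pow_of_inducedCMType`): a Kähler-polarized CM power member with HC on every
right-sign row. [cite: Deligne1982HodgeCycles, §5 (c) pp. 38–39] [cite: Gordon1999HodgeAVSurvey, Thm. 6.4 and §9.3] -/
theorem exists_cmPower_kaehler_hodgeConjectureFor_of_inducedCMType_of_sign (hK : 2 < Module.finrank ℚ K)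
    {b₀ : 𝓞 K} (hb₀ : IsCMField.complexConj K (b₀ : K) = -(b₀ : K))
    (hsep : Function.Injective fun σ : K →+* ℂ => σ (b₀ : K))
    {R : Polynomial ℤ} {e₀ : ℕ} (he : Module.finrank ℚ K = 2 * e₀) (hRm : R.Monic) (hRdeg : R.natDegree = e₀)
    (hR : R.comp (X ^ 2) = minpoly ℤ b₀) (hirr : Irreducible (cmPolyQ R))
    (hroots : ∀ s : ℂ, Polynomial.eval₂ (Int.castRingHom ℂ) s R = 0 → s.im = 0 ∧ s.re < 0)
    (haev : Polynomial.aeval (b₀ : K) (cmPolyQ R) = 0) (hdegQ : (cmPolyQ R).natDegree = Module.finrank ℚ K)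
    [Fact (Irreducible (realPolyQ R))]
    {Φ₁ : CMType K₁} {Φ : CMType K} (hΦ : inducedCMType (algebraMap K₁ K) Φ₁ = Φ) (hΦ₁ : IsNondegenerate Φ₁)
    {B : AbelianVariety ℂ} {ι : 𝓞 K →+* End B} {θ : K →+* Module.End ℂ (complexBetti B.X 1)}
    (hB : IsCMTypeRealisation Φ B ι θ) {p : ℕ} (hp : 0 < p)
    {q : (realField R)ˣ} (hqsign : ∀ τ : cmField R →+* ℂ, 0 < (-1 : ℝ) ^ p * (τ (realToCM R (q : realField R))).re) :
    ∃ (η : (⨁ fun _ : Fin (2 * p) => B) ⟶ ⨁ fun _ : Fin (2 * p) => B)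
      (h : complexBetti (⨁ fun _ : Fin (2 * p) => B).X 2),
      IsOfCMType (⨁ fun _ : Fin (2 * p) => B) ∧ IsWeilTypeCM (⨁ fun _ : Fin (2 * p) => B) η R e₀ p ∧
      IsRationalClass h ∧ IsKaehlerMultiple (⨁ fun _ : Fin (2 * p) => B) h ∧
      IsPolarizationClass (⨁ fun _ : Fin (2 * p) => B).dim (⨁ fun _ : Fin (2 * p) => B).X h ∧
      RosatiCompatible (⨁ fun _ : Fin (2 * p) => B) η h ∧
      HasWeilDiscriminantCM (⨁ fun _ : Fin (2 * p) => B) η R e₀ p h (QuotientGroup.mk q) ∧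
      HodgeConjectureFor (⨁ fun _ : Fin (2 * p) => B).dim (⨁ fun _ : Fin (2 * p) => B).X ∧
      weilClassesField (⨁ fun _ : Fin (2 * p) => B) η (R.comp (X ^ 2)) (2 * p) ≤
        algebraicClasses (⨁ fun _ : Fin (2 * p) => B).X p := by
  obtain ⟨act, h, -, hcm, hW, hQ, hKm, hpol, hros, hdisc⟩ :=
    exists_cmPower_kaehler_hasWeilDiscriminantCM_of_sign K hK hb₀ hsep he hRm hRdeg hR hirr hroots haev hdegQ hB hp hqsign
  have hHC := hodgeConjectureFor_pow_of_inducedCMType K hΦ hΦ₁ hB (2 * p)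
  exact ⟨_, h, hcm, hW, hQ, hKm, hpol, hros, hdisc, hHC,
    hW.weilClassesField_le_algebraicClasses_of_hodgeConjectureFor hHC⟩

end PolarizedHodge

end Summit.HodgeConjecture.HodgeConjecture.Ring2.WeilCoverageCM

end
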